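import Summits.Langlands.Langlands.Theses.SkinnerWilesDefectOne
import Summits.Langlands.Langlands.Theorems.ProModularOrdinaryClassical.Negative.LoadBearing
import Summits.Langlands.Langlands.Theorems.ProModularOrdinaryClassical.Negative.PointsIntegral
import Literature.NumberTheory.Automorphic.OrdinaryCompletedCohomologyGL

/-!
# Line `paskunas-centre-split` — checked skeleton (gen 2) for the crux
`Summit.Langlands.Langlands.Theses.SkinnerWilesDefectOne.ProModularOrdinaryClassical` (stmt-Langlands-12921)

Planner crux-plan, round 1, generation 2 (idea card `Cruxes/ProModularOrdinaryClassical/Ideas/paskunas-centre-split.md`,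
merged by the triage panel with `split-prime-paskunas-fibre` (same lever); line card
`Cruxes/ProModularOrdinaryClassical/Lines/paskunas-centre-split.md`; triage `TRIAGE-r1-{1,2,3}.md`, 3/3 pass).
Four registered stubs `stub_*` (the only `sorry`s of the file) and the kernel-checked composition

  `ProModularOrdinaryClassical_of : S.stub_tameLevelSaturation → S.stub_centreForcesOrdinary →
     S.stub_complementRegimeFactorisation → S.stub_classicalOfOrdinaryPoint → ProModularOrdinaryClassical`

(pure logic: case split on "`5 ≤ p` and `p` has two distinct places in `F`", i.e. `p ≥ 5` split in the
imaginary quadratic field `F`).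

WHAT CHANGED SINCE GEN 1 (skeleton sha fb86b3fc…, 4 stubs `centreForcesSlopeZero → slopeZeroFactorisation →
outOfScopeFactorisation → classicalOfOrdinaryPoint`). Two re-cuts, no change of idea:
(1) the seam "lever ⇒ slope-zero point of `𝕋^S(𝒰'; p)`, then slope zero ⇒ ordinary point" is replaced by
"lever ⇒ ordinary point" (`stub_centreForcesOrdinary` concludes `𝒰.IsOrdinarilyPadicallyAutomorphic ρ` itself):
Emerton's ordinary part `Ord_B(H̃•(K^p))` is compared in print with Hida's ORDINARY completed cohomology of the
Iwahori tower (ACC+ §5.2, CN23 Prop. 2.2.8), so the lever lands directly in `𝕋^{S,ord}(𝒰)`; the slope-zero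
point of `𝕋^S(𝒰; p)` is the trivial corollary (`IsOrdinarilyPadicallyAutomorphic.isIwahoriPadicallyAutomorphic`),
and gen 1's `stub_slopeZeroFactorisation` (the converse) was off the proof path — dropped.
(2) the change of tame level hidden inside gen 1's XL lever ("`∃ 𝒰` arbitrary at `p` ⇒ a level maximal above
`p`") is carved out as the NEW stub `stub_tameLevelSaturation` — typeable, true for `p ≥ 5`, independently
provable, and the typeable shadow of the fibre/occurrence step (A0) that triage r1-3 (c) asked to see; the
lever now lives at ONE tame level maximal above `p`, as Emerton/Hida theory is always stated.
`stub_classicalOfOrdinaryPoint` is byte-identical to gen 1 and to line `ordinary-patching-by-regime`'s stub of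
the same name (one proof closes both); the conceded complement keeps gen 1's statement under the name
`stub_complementRegimeFactorisation`.

THE CRUX (fixed; route SkinnerWilesDefectOne, rank 4, THE EXIT). `F` imaginary quadratic, `p` odd,
`ρ : Γ_F → GL₂(ℚ̄_p)` irreducible, a.e. unramified, `p`-adically automorphic of some tame level
(`∃ 𝒰, 𝒰.IsPadicallyAutomorphic ρ`: a continuous `ℚ̄_p`-point `x` of the completed-cohomology Hecke algebra
`𝕋(𝒰)` of the Bianchi tower, SPHERICAL operators only) and ordinary of ONE parallel weight `k ≥ 2` with an
inertial exponent `m > 0` at every `v ∣ p` ⟹ `∃ π` cuspidal L-algebraic on `GL₂(𝔸_F)` with Satake–Frobenius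
matching a.e. Its whole open content is (OF) "Galois-ordinary ⇒ the eigensystem lies in Hida's ordinary part"
(crux NOTES §1; Disproof §4 NEXT REGIMES).

THE LEVER (card; Paškūnas, Publ. IHÉS 118 (2013) = arXiv:1005.2008, Thm 1.5: the centre of a block `𝔅` of
locally finite `GL₂(ℚ_p)`-representations is the pseudo-deformation ring `Z_𝔅 ≅ R^{ps}`; Thm 1.11 / Cor 1.2:
over a point of `Spec Z_𝔅[1/p]` whose pseudo-character is REDUCIBLE, `ψ₁ + ψ₂`, every irreducible admissible
unitary Banach object of the block is a subquotient of the two unitary principal series). At a place `v ∣ p`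
with `F_v = ℚ_p` — both places, when `p` splits — apply this to the `𝔭_x`-part `Π_x` of Emerton's completed
cohomology of the Bianchi tower of a tame level `𝒰` maximal above `p`: IF the centre acts on `Π_x` through the
character of `R^{ps}` given by `tr ρ_x|_{Γ_{F_v}}` ("centre-level local–global compatibility", a TRACE identity
— the open core), then local reducibility of `ρ_x` at `v` puts `Π_x` over a reducible point, its `G_v`-socle
consists of principal-series / `Ŝt ⊗ η` constituents (one-dimensional `η ∘ det` excluded by irreducibility of
`ρ_x`), Emerton's `Ord_B(Π_x) ≠ 0` (with UNIT Hecke eigenvalue of `diag(ϖ, 1)`: the `ψ_i` are unitary), and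
Emerton's ordinary part of `H̃•(K^p)` IS Hida's ordinary completed cohomology of the Iwahori tower (ACC+ §5.2,
CN23 Prop 2.2.8): the spherical eigensystem `x` extends to a CONTINUOUS point of Hida's (nearly) ordinary big
Hecke algebra `𝕋^{S,ord}(𝒰)` — `𝒰.IsOrdinarilyPadicallyAutomorphic ρ`. That deliverable is
`S.stub_centreForcesOrdinary` (S1). It is WEIGHT-BLIND on purpose: the centre sees only `tr ρ_x|_{Γ_{F_v}}`
(triage r1-2 (ii), r1-3 (b): the companion constituent is unitary too), and `𝕋^{S,ord}(𝒰)` is the NEARLY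
ordinary algebra (full diamonds `T(𝒪_v)` in `hidaLevel`, no weight pinned — triage r1-2), so its hypothesis is
bare local reducibility (`∃ k m, IsOrdinaryOfWeightAt p ρ v k m`; with `m = 0` this is upper-triangularisability,
`Negative.isOrdinaryOfWeight_exponent_zero_iff`) and every weight matter is moved into S4.

SHAPE. S0 (`stub_tameLevelSaturation`: pro-modular of some tame level ⇒ pro-modular of a tame level MAXIMAL
above `p` — the `p`-power towers of `U` and of its `p`-saturation `U^p × ∏_{v∣p} GL₂(𝒪_v)` coincide from some
level on; `p ≥ 5` keeps every arithmetic group `p`-torsion-free, so cohomological degrees are bounded and the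
Hochschild–Serre nilpotence argument transfers continuous points) → S1 (lever, split `p ≥ 5`, at that level) →
`IsOrdinarilyPadicallyAutomorphic`; on the complementary regime (`p = 3`, or `p` inert / ramified, where
`ModPLanglandsGL2BeyondQpFpBar` bites: no blocks / centre for `GL₂(ℚ_{p²})` or ramified quadratic `F_v`) the
same conclusion is the CONCEDED stub S3 (`stub_complementRegimeFactorisation`) — NOT a lemma of this line (the
paired idea `theta-spin-host` failed triage 3/3; owners: line `ordinary-patching-by-regime` regimes R1/R2/R3,
or the tenure planner's retyping of the engine's output as ordinary pro-modularity, crux NOTES §3), recorded only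
so that the composition concludes the crux BY NAME for every odd `p`; then S4 (`stub_classicalOfOrdinaryPoint`:
irreducible + ORDINARILY pro-modular at a level maximal above `p` + Galois-ordinary of parallel weight `k ≥ 2`,
`m > 0` ⇒ classical) — the route's foreseen child `HidaControlGL2F` in its honest form (= ideator 3's
`ClassicalOfOrdinaryPoint`, = the target of line `top-degree-exact-control`), which carries the weight character
of the ordinary point (triage shared note (S1)), the companion case (`ρ|Γ_{F_v}` split), Khare–Thorne
top-degree exact control and the Eichler–Shimura–Harder dictionary over `F`.

DISPROOF USED (`Cruxes/ProModularOrdinaryClassical/Disproof.lean`, cdisprove gen 1 cycles 1–2, v2 read in full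
2026-08-16; it has NO `_false_without_` theorem — none can exist short of ¬FM, §0). §0
`crux_of_ordinaryFontaineMazur`: honoured — pro-modularity `hpm` is CONSUMED by S0/S1 (the lever acts on the
module `Π_x` cut out by `x`) and by S3 (its hypothesis), and S4 consumes ORDINARY pro-modularity; no stub is
FM-in-disguise except, avowedly, whatever proof S3 eventually gets on the generic residual locus (ACC+ Thm 6.1.2
regime, triage r1-3). §1a (`hunr` decoration, `eventually_isUnramifiedAt_of_isPadicallyAutomorphic`, landed in
`Negative/LoadBearing.lean`, imported): no stub asks for `hunr`; the composition discards it. §1b (uniform `m`):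
immaterial. §1c (`0 < m` load-bearing): used exactly in S4 (arithmetic weight for control / locally algebraic
vectors); S1 is stated at `m`-free strength deliberately (Hecke-ordinarity, unlike classicality, is predicted for
every locally reducible pro-modular `ρ`, e.g. non-arithmetic specialisations of nearly ordinary families) — the
proved lemma `leverHypothesis_of_upperTriangular` locates the disprover's `m = 0` degeneration inside S1's
hypothesis, i.e. AWAY from the stub (S4) where the weight is consumed. §1d (`2 ≤ k` method-only): only S4.
§1e (irreducibility load-bearing): used in S1 (exclusion of one-dimensional `G_v`-constituents / `Ĥ⁰`) and in
S4 (interior = cuspidal). §2 (`WithPerPlaceWeights`): not claimed. Landed Negative lemmas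
(`Negative/LoadBearing.lean`, `Negative/PointsIntegral.lean` — both imported): hygiene / integrality lemmas
only, no `¬`-statement; no stub is an instance they refute. DISPROOF v3 (cdisprove gen 2 cycle 2, tree commit
b61b6b1e8b01, read at the turn boundary 2026-08-16T03:00Z) §7 pre-attack honoured: (S1) "`SlopeDichotomy` is
valuation theory — do not file it as a stub": this skeleton has NO slope stub at all (the lever lands in
`𝕋^{S,ord}(𝒰)`; `leverConclusion_point_integral` below records that its point is integral, §6
`norm_apply_le_one_of_continuous_ord`); (S2) "the typed split clause admits ramified `p`": the scope is two
DISTINCT places above `p` (= `SplitsCompletelyAt` for `[F:ℚ] = 2`); (S3) "`OrdinaryPointsClassical` hides a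
Galois ⇒ Hecke weight statement": avowed as S4 (B1), the second-hardest step; (S4) the `ζ_p ∈ F` /
ramified corner lies in the conceded S3 and in the `p`-agnostic S4, never in the lever.
Negatives index (`ledger negatives --problem Langlands`, 1 entry, K3 Kuga–Satake anchor): unrelated.
-/

set_option linter.dupNamespace false
set_option linter.unusedVariables false

noncomputable section

namespace Summit.Langlands.Langlands.Cruxes.ProModularOrdinaryClassical.PaskunasCentreSplit

open Summit.Langlands.Langlands.Theses.SkinnerWilesDefectOne
open Summit.Langlands.Langlands.Theorems.ProModularOrdinaryClassical.Negative
open Literature.NumberTheory.Automorphic Literature.NumberTheory.GaloisRepresentations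
open Literature.NumberTheory.Automorphic.BigHeckeGLn
open NumberField IsDedekindDomain Filter

/-! ## 1. The statements of the four stubs (`S.stub_*`; taken BY NAME as the hypotheses of
`ProModularOrdinaryClassical_of`; the sorried witnesses `stub_*` of §2 restate them verbatim) -/

/-- **STUB 0 — `tameLevelSaturation` (infrastructure of the constructed big Hecke algebras; size M
mathematically, L in Lean; PROVABLE).** For `F` imaginary quadratic, `p ≥ 5` and any `ρ : Γ_F → GL₂(ℚ̄_p)`:
if `ρ` is `p`-adically automorphic of SOME `S`-good tame level `𝒰 = (U, S)` (arbitrary level at `p`), then it is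
`p`-adically automorphic of a tame level `𝒰' = (U', S)` that is MAXIMAL ABOVE `p` (`TameLevel.IsMaximalAbove`:
`U' ⊇ ι_v(GL₂(𝒪_v))` and factorizable at every `v ∣ p`). Intended proof: `U' := {g ∈ GL₂(𝒪̂_F) | strip_p(g) ∈ U}`
with `strip_p(g) = g · ∏_{v∣p} ι_v(g_v)⁻¹` (a `TameLevel` with the same `bad`, maximal above `p`; hyperspecial /
factorizable at `w ∉ S` from the same properties of `U`); `U` open ⇒ `ι_v(K_v(ϖ_v^{r₀})) ⊆ U` for `v ∣ p`, whence
the `p`-power towers AGREE from `r₀` on: `𝒰.tower r = 𝒰'.tower r` for `r ≥ r₀` (elementwise: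
`g = strip_p(g) · ∏ ι_v(g_v)`); so `𝕋(𝒰)` and `𝕋(𝒰')` both restrict continuously, with dense image, to the
algebra `𝕋_{≥r₀}` generated on the common levels; the kernel of `𝕋(𝒰) → 𝕋_{≥r₀}` acts NILPOTENTLY at the low
levels (Hecke-equivariant Hochschild–Serre `H^a(U_r/U_{r₀}, H^b(X_{U_{r₀}})) ⇒ H^{a+b}(X_{U_r})` in the
group-cohomology model: `Fun(G/U_{r₀}, k)` is coinduced for the free right action of `U_r/U_{r₀}`; an operator
vanishing on `E₂` is nilpotent of order ≤ the filtration length on the abutment), with nilpotence order bounded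
because `H^i(X_{U_r}, ℤ/p^s) = 0` for `i > 3` at EVERY level — here `p ≥ 5` is used: `GL₂(F)`, `F` imaginary
quadratic, has no element of order `p ≥ 5` (`[F(ζ_p):F] ≥ 3`), units have order prime to `p`, so the arithmetic
groups act on `ℍ³` with prime-to-`p` stabilisers; hence a continuous `x : 𝕋(𝒰) → ℚ̄_p` (domain!) kills that
kernel and factors through `𝕋_{≥r₀}`; finiteness of `H^i(X_{U_r}, ℤ/p^s)` (Shapiro + finiteness of class numbers
+ Borel–Serre for Bianchi-type groups) makes both restrictions surjective (compact, dense image), so `x` descends to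
a continuous point `x'` of `𝕋(𝒰')` with the same `T_{w,j}`-eigenvalues, `w ∉ S`; association is unchanged.
WHY IT MIGHT FAIL: only Lean depth (transport of `levelCohomology` along an equality of level subgroups;
Hochschild–Serre functoriality for `groupCohomology`; Borel–Serre finiteness — none in Mathlib); for `p = 3`
(outside this stub) level-`0` Farrell cohomology of `3`-torsion would make the degree bound fail.
[GeeNewton2020 §2.1 (independence of 𝕋 of the level structure up to nilpotents, Rem. 2.1.6–2.1.7);
CalegariEmerton2011 §1.1 (cofinal towers); BorelSerre1973; Serre, *Cohomologie des groupes discrets* (1971) §1] -/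
def S.stub_tameLevelSaturation : Prop :=
  ∀ (F : Type) [Field F] [NumberField F], IsTotallyComplex F → Module.finrank ℚ F = 2 →
    ∀ (p : ℕ) [Fact p.Prime], 5 ≤ p →
    ∀ (ρ : FramedGaloisRep F (PadicAlgCl p) 2),
    (∃ 𝒰 : TameLevel 2 F p, 𝒰.IsPadicallyAutomorphic ρ) →
    ∃ 𝒰' : TameLevel 2 F p, 𝒰'.IsMaximalAbove ∧ 𝒰'.IsPadicallyAutomorphic ρ

/-- **STUB 1 — `centreForcesOrdinary` (THE LEVER = the route's foreseen child `OrdinaryFactorisation` on the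
split locus, weight-blind; size XL; the lead holds this one).** For `F` imaginary quadratic, `p ≥ 5` with two
distinct places of `F` above it (so `F_v = ℚ_p` at both), a tame level `𝒰` MAXIMAL ABOVE `p`, and
`ρ : Γ_F → GL₂(ℚ̄_p)` irreducible, `p`-adically automorphic of tame level `𝒰` (continuous point `x` of `𝕋(𝒰)`,
spherical operators only) and REDUCIBLE on `Γ_{F_v}` for every `v ∣ p` (typed as `∃ k m, ρ.IsOrdinaryOfWeightAt
p v k m` — any weight, any exponent, `m = 0` allowed: upper-triangularisable), `ρ` is ORDINARILY `p`-adically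
automorphic of the SAME tame level: its `T_{w,j}`-eigensystem extends to a continuous `ℚ̄_p`-point of Hida's
(nearly) ordinary big Hecke algebra `𝕋^{S,ord}(𝒰) = OrdinaryHeckeAlgebraGLn 𝒰` (equivalently: `x` lies in the
support of the ordinary completed cohomology `e·H̃•` of the Hida tower `U(r) = U^p × ∏_{v∣p} Iw_v(r, max r 1)`).
Intended proof (helpers ride with `--supports stmt-Langlands-12921`; each named in the line card):
(A0) fibre non-vanishing — the `𝔭_x`-part `Π_x := (H̃^i(U^p) ⊗ E)[𝔭_x]` of Emerton's completed cohomology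
(`i = 1` or `2`) is a non-zero unitary Banach representation of `G_p = GL₂(F_v) × GL₂(F_{v̄})`, locally admissible
mod `ϖ` (triage r1-3 (c); the continuous point factors through the faithful Hecke algebra of `H̃^{≤3}` by the
same bounded-degree nilpotence as S0); (A1) WLOG a central character (Thm 1.11 lives in `Ban_{G,ζ}`; the centre
`Z(F_v)` acts on the finite-dimensional `𝔭_x`-eigenspaces of `K_v(r)`-invariants; triage r1-1);
(A2) CENTRE-LEVEL LOCAL–GLOBAL COMPATIBILITY — the OPEN CORE: the Paškūnas centre `Z_𝔅 ≅ R^{ps}_{tr ρ̄|Γ_{F_v}}`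
of each block `𝔅` met by `Π_x|_{GL₂(F_v)}` acts on `Π_x` through `tr ρ_x|_{Γ_{F_v}}` (input: Scholze's
`𝕋_𝔪/I`-valued determinant for the CM field `F`, Scholze2015 Thm V.4.1 / Newton–Thorne `I⁴ = 0`, which EXISTS at
Eisenstein `𝔪`; candidate proofs: transport it `M(ℚ_p)`-equivariantly through the Siegel boundary of `U(2,2)` at
torsion level, ACC+ §5.4; or Gee–Newton patched completed homology + CN23 Thm 4.2.15 (cr) with its hypothesis
(1) removed over `F` itself — no `p`-adic base change of `x` exists); (A3) Paškūnas Thm 1.11 / Cor 1.2 + the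
Artinian-socle argument (`E_𝔅` finite over the Noetherian centre, Prop 1.16): `Π_x` has an irreducible
admissible closed `GL₂(F_v)`-SUBrepresentation which is a unitary principal series or `Ŝt ⊗ η` — (A4) not
`η ∘ det`: `SL₂(F_v)`-invariant eigenvectors of `H̃•` are Eisenstein (strong approximation + the congruence
subgroup property of `SL₂(𝒪_F[1/v])`, Serre 1970, `S`-rank 2), excluded by irreducibility of `ρ` (Disproof §1e;
triage r1-2/r1-3 sharpen (a): `Ord_B(η∘det) = 0` is why (A4) is needed); (A5) `Ord_B` of such a constituent is
`≠ 0`, `T(ℤ_p)` acting through a continuous character and `diag(ϖ,1)` by a UNIT (Emerton, Ord. parts I,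
Def 3.1.9, Thm 4.4.6; `ψ_i` unitary, BOTH orderings give units — triage r1-2 §A, r1-3 (b)); repeat
at `v̄` on `Ord_{B(F_v)}(Π_x)` (admissible `GL₂(F_{v̄}) × T(F_v)`-representation in the same block component);
(A6) Emerton's ordinary part of `H̃•(U^p)` is Hida's ordinary completed cohomology of the Iwahori tower of the
SAME tame level (ACC+ §5.2, CN23 Prop 2.2.8; `𝒰.IsMaximalAbove` makes `U(r) = U^p × ∏ Iw_v(r, max r 1)`), whence
the `T⁺ × 𝕋^S`-eigensystem of the ordinary vector is a continuous point of `𝕋^{S,ord}(𝒰)` (nearly ordinary: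
the diamonds `⟨u⟩_v` act through the restriction of the Ord-character to `T(𝒪_v)`, no weight condition) with the
same `T_{w,j}`-eigenvalues — `𝒰.IsOrdinarilyPadicallyAutomorphic ρ`.
WHY IT MIGHT FAIL: (A2) is unproved at ANY `𝔪` for a `p`-adic (non-classical) `x` over an imaginary quadratic
field (one place of `F⁺ = ℚ` above `p`: CN23 4.2.15 hyp. (1); classical points not Zariski dense in
`Spec 𝕋(K^p)_𝔪`, Calegari–Mazur, so no interpolation proof) — it is strictly weaker than module-level LGC but
still open; at Eisenstein `𝔪` even the Gee–Newton set-up needs the unbuilt nice-prime patching. Barrier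
`ModPLanglandsGL2BeyondQpFpBar` evaded ONLY because `F_v = ℚ_p` (hence the split scope); `p ≥ 5` is Paškūnas'
standing hypothesis (p = 2, 3: Paškūnas–Tung) and keeps the arithmetic groups `p`-torsion-free.
[arXiv:1005.2008 Thms 1.5, 1.11, Prop 1.16, Cor 1.2; Colmez–Dospinescu–Paškūnas 2014 Thm 1.1;
Emerton2011LocalGlobal; Emerton, Ordinary parts I/II (Astérisque 331); AllenCalegariCaraianiGeeEtAl2023 §5.2,
§5.4; CaraianiNewton2023 Prop 2.2.8, Thm 4.2.15; GeeNewton2020; Scholze2015 Thm V.4.1, Cor V.4.3; NewtonThorne2016;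
Serre, Ann. of Math. 92 (1970)] -/
def S.stub_centreForcesOrdinary : Prop :=
  ∀ (F : Type) [Field F] [NumberField F], IsTotallyComplex F → Module.finrank ℚ F = 2 →
    ∀ (p : ℕ) [Fact p.Prime], 5 ≤ p →
    (∃ v w : HeightOneSpectrum (𝓞 F), v ≠ w ∧ (p : 𝓞 F) ∈ v.asIdeal ∧ (p : 𝓞 F) ∈ w.asIdeal) →
    ∀ (𝒰 : TameLevel 2 F p), 𝒰.IsMaximalAbove →
    ∀ (ρ : FramedGaloisRep F (PadicAlgCl p) 2), ρ.toGaloisRep.IsIrreducible →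
    𝒰.IsPadicallyAutomorphic ρ →
    (∀ v : HeightOneSpectrum (𝓞 F), (p : 𝓞 F) ∈ v.asIdeal →
        ∃ k m : ℕ, ρ.IsOrdinaryOfWeightAt p v k m) →
    𝒰.IsOrdinarilyPadicallyAutomorphic ρ

/-- **STUB 3 — `complementRegimeFactorisation` — NOT A LEMMA OF THIS LINE: the conceded complement (size:
open problem).** For `F` imaginary quadratic and odd `p` OUTSIDE the lever's regime — `p = 3`, or `p` inert or
ramified in `F` (not "`5 ≤ p` with two distinct places above `p`") — the route's foreseen child
`OrdinaryFactorisation` under exactly the crux's hypotheses: irreducible, pro-modular, Galois-ordinary of one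
parallel weight `k ≥ 2` with exponent `m > 0` at every `v ∣ p` ⟹ ordinarily pro-modular of some tame level
maximal above `p` (the sibling line's `OrdProMod p ρ`, verbatim). The block/centre lever is void there
(`GL₂(ℚ_{p²})`, ramified quadratic `F_v`: supersingular blocks contain principal series in their Ext-closure,
Breuil–Paškūnas; no centre in print — barrier `ModPLanglandsGL2BeyondQpFpBar`); the paired idea
`theta-spin-host` FAILED triage (3/3). Recorded only so that the composition concludes
`ProModularOrdinaryClassical` BY NAME for every odd `p`. Owners: line `ordinary-patching-by-regime` (its
composition yields `OrdProMod` in regimes R2/R3 and, via ACC+ Rem. 6.1.3 "ρ contributes to the ordinary part",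
in R1); the tenure planner's recommended retyping of the engine crux to `IsOrdinarilyPadicallyAutomorphic`
(crux NOTES §3), which makes this stub unnecessary for the route's own `closes`; split `p = 3` may move into
STUB 1 via Paškūnas–Tung (blocks and centre for `p = 2, 3`) plus a Farrell-cohomology argument at Hida level
`r ≤ 1` — the lead's call. No prover of THIS line should claim it. WHY IT MIGHT FAIL: = (OF) off the split
locus, image-hypothesis-free ordinary automorphy lifting at defect one (NegativeNotes B0); false only with
¬FM-type phenomena for `p`-adic eigensystems. [AllenCalegariCaraianiGeeEtAl2023 Thm 6.1.2, Rem. 6.1.3;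
BreuilPaskunas2012; CaraianiNewton2023; PaskunasTung2021] -/
def S.stub_complementRegimeFactorisation : Prop :=
  ∀ (F : Type) [Field F] [NumberField F], IsTotallyComplex F → Module.finrank ℚ F = 2 →
    ∀ (p : ℕ) [Fact p.Prime], p ≠ 2 →
    ¬ (5 ≤ p ∧ ∃ v w : HeightOneSpectrum (𝓞 F), v ≠ w ∧ (p : 𝓞 F) ∈ v.asIdeal ∧
        (p : 𝓞 F) ∈ w.asIdeal) →
    ∀ (ρ : FramedGaloisRep F (PadicAlgCl p) 2), ρ.toGaloisRep.IsIrreducible →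
    (∃ 𝒰 : TameLevel 2 F p, 𝒰.IsPadicallyAutomorphic ρ) →
    (∃ k : ℕ, 2 ≤ k ∧ ∃ m : ℕ, 0 < m ∧ ∀ v : HeightOneSpectrum (𝓞 F), (p : 𝓞 F) ∈ v.asIdeal →
        ρ.IsOrdinaryOfWeightAt p v k m) →
    ∃ 𝒰' : TameLevel 2 F p, 𝒰'.IsMaximalAbove ∧ 𝒰'.IsOrdinarilyPadicallyAutomorphic ρ

/-- **STUB 4 — `classicalOfOrdinaryPoint` (the exit's second half, `p`-agnostic; size L–XL; SHARED verbatim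
with line `ordinary-patching-by-regime`'s stub of the same name and with line `top-degree-exact-control`'s
`OrdinaryPointsClassical` / ideator 3's `ClassicalOfOrdinaryPoint`).** For `F` imaginary quadratic, `p` odd, `ρ`
irreducible, ORDINARILY `p`-adically automorphic of some tame level maximal above `p` (a continuous
`ℚ̄_p`-point `x_ord` of Hida's `𝕋^{S,ord}(𝒰)`) and Galois-ordinary of ONE parallel weight `k ≥ 2` with
exponent `m > 0` at every `v ∣ p`, there is a cuspidal L-algebraic `π` on `GL₂(𝔸_F)` with Satake–Frobenius
matching at almost all places (the crux's conclusion verbatim). Intended proof: (B1) WEIGHT CHARACTER AT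
`x_ord` — the diamonds `ordDiamondHom` act at `x_ord` through the DOMINANT arithmetic weight-`k` character of
`T(𝒪_v)` read off `ρ|_{I_v}` (`θ₁ = ε^{k-1}·`finite, `θ₂` finite, from `IsOrdinaryOfWeightAt` with `0 < m`,
Disproof §1c): a Galois ⇒ Hecke statement WITH diamonds for `𝕋^{S,ord}`-valued determinants over an
imaginary quadratic field (triage shared note (S1): in print only for classical `π` via cyclic base change;
CN23 Thm 4.2.15 needs two places of `F⁺` above `p`), including the COMPANION CASE: when `ρ|Γ_{F_v}` splits,
`x_ord` may be the anti-dominant ("weight `2 - k`") refinement — then either a reflection argument produces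
the dominant refinement with the same spherical eigensystem, or the conclusion is reached directly (FM still
predicts it: triage r1-2 §B); (B2) Khare–Thorne top-degree EXACT control for the perfect `Λ_F`-complex of
ordinary chains (KT Prop 6.6 / Cor 6.8; the edge argument of card `top-degree-exact-control`, verified by
triage r1-2 §E: no torsion-freeness input) + Nakayama at the characteristic-`0` prime `𝔭_x ⊇ P_k`: the
eigensystem occurs in `H^q_{ord}(X_{U₀(p^r)}, V_{(k,k)}) ⊗ ℚ̄_p`, `q ∈ {1, 2}`; (B3) interior = cuspidal since
`ρ` is irreducible (boundary eigensystems carry reducible pseudo-characters; Harder 1987); (B4) the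
Eichler–Shimura–Harder / Borel–Franke dictionary over `F` from a cuspidal weight-`(k,k)` eigenclass to an
L-algebraic cuspidal `π` with `T_{w,j} ↦` Satake parameters in the normalisation of `SatakeFrobCompatibleAt`
(arithmetic Frobenius, `heckeFrobPoly` vs `arithFrobPolyOfSatake`; the tree's `cuspidalEigenclass_exists` /
`interiorEigenclass_isCuspidal` are `GL_n/ℚ` only — unvendored over `F`, triage r1-2 leans-on note).
Neatness: for `p = 3` use Hida level `r ≥ 2` / a neat auxiliary tame level (triage r1-3 (b)). WHY IT MIGHT
FAIL: (B1) is not in print for `p`-adic points over `F` and hides the companion ambiguity; Hida/KT control over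
a field with a complex place has `Λ_F`-torsion ordinary modules (Calegari–Mazur) — harmless for the top-degree
edge but the weight locus `P_k` must actually pass through `𝔭_x`, which is (B1) again. Uses `hpm` in its
ordinary form (Disproof §0 honoured). [KhareThorne2017 Prop 6.6, Cor 6.8; Hida1993Duke; Hida1994AIF;
Harder1987; CaraianiNewton2023 Thm 4.2.15; CalegariMazur2008; Emerton2006 §2.2] -/
def S.stub_classicalOfOrdinaryPoint : Prop :=
  ∀ (F : Type) [Field F] [NumberField F], IsTotallyComplex F → Module.finrank ℚ F = 2 →
    ∀ (p : ℕ) [Fact p.Prime], p ≠ 2 →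
    ∀ (hcpt : isCompact_glFiniteIntegralLevel 2 F) (ι : PadicAlgCl p ≃+* ℂ)
      (ρ : FramedGaloisRep F (PadicAlgCl p) 2), ρ.toGaloisRep.IsIrreducible →
    (∃ 𝒰 : TameLevel 2 F p, 𝒰.IsMaximalAbove ∧ 𝒰.IsOrdinarilyPadicallyAutomorphic ρ) →
    (∃ k : ℕ, 2 ≤ k ∧ ∃ m : ℕ, 0 < m ∧ ∀ v : HeightOneSpectrum (𝓞 F), (p : 𝓞 F) ∈ v.asIdeal →
        ρ.IsOrdinaryOfWeightAt p v k m) →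
    ∃ π : CuspidalAutomorphicRepData 2 F hcpt, π.1.IsLAlgebraic ∧
      ∀ᶠ v in cofinite, Summit.Langlands.SatakeFrobCompatibleAt ι π.1 ρ v

/-! ## 2. The four registered stubs (the only `sorry`s of the line; statements = §1 verbatim, fully
qualified, so that a Theorems-side `--supports stmt-Langlands-12921` proof can restate them textually) -/

/-- **stub_tameLevelSaturation** — registered form (statement = `S.stub_tameLevelSaturation`).
[M (math) / L (Lean): cofinal `p`-power towers + Hecke-equivariant Hochschild–Serre nilpotence + bounded
cohomological degree for `p ≥ 5` + Borel–Serre finiteness.] -/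
theorem stub_tameLevelSaturation : ∀ (F : Type) [Field F] [NumberField F], NumberField.IsTotallyComplex F → Module.finrank ℚ F = 2 → ∀ (p : ℕ) [Fact p.Prime], 5 ≤ p → ∀ (ρ : Literature.NumberTheory.GaloisRepresentations.FramedGaloisRep F (PadicAlgCl p) 2), (∃ 𝒰 : Literature.NumberTheory.Automorphic.BigHeckeGLn.TameLevel 2 F p, 𝒰.IsPadicallyAutomorphic ρ) → ∃ 𝒰' : Literature.NumberTheory.Automorphic.BigHeckeGLn.TameLevel 2 F p, 𝒰'.IsMaximalAbove ∧ 𝒰'.IsPadicallyAutomorphic ρ := by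
  sorry

/-- **stub_centreForcesOrdinary** — THE LEVER, registered form (statement = `S.stub_centreForcesOrdinary`).
[XL; open core = centre-level local–global compatibility (A2); everything else in print or routine.] -/
theorem stub_centreForcesOrdinary : ∀ (F : Type) [Field F] [NumberField F], NumberField.IsTotallyComplex F → Module.finrank ℚ F = 2 → ∀ (p : ℕ) [Fact p.Prime], 5 ≤ p → (∃ v w : IsDedekindDomain.HeightOneSpectrum (NumberField.RingOfIntegers F), v ≠ w ∧ (p : NumberField.RingOfIntegers F) ∈ v.asIdeal ∧ (p : NumberField.RingOfIntegers F) ∈ w.asIdeal) → ∀ (𝒰 : Literature.NumberTheory.Automorphic.BigHeckeGLn.TameLevel 2 F p), 𝒰.IsMaximalAbove → ∀ (ρ : Literature.NumberTheory.GaloisRepresentations.FramedGaloisRep F (PadicAlgCl p) 2), ρ.toGaloisRep.IsIrreducible → 𝒰.IsPadicallyAutomorphic ρ → (∀ v : IsDedekindDomain.HeightOneSpectrum (NumberField.RingOfIntegers F), (p : NumberField.RingOfIntegers F) ∈ v.asIdeal → ∃ k m : ℕ, ρ.IsOrdinaryOfWeightAt p v k m) → 𝒰.IsOrdinarilyPadicallyAutomorphic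 ρ := by
  sorry

/-- **stub_complementRegimeFactorisation** — the CONCEDED COMPLEMENT, registered form (statement =
`S.stub_complementRegimeFactorisation`). [open problem; not a lemma of this line — see the def's docstring.] -/
theorem stub_complementRegimeFactorisation : ∀ (F : Type) [Field F] [NumberField F], NumberField.IsTotallyComplex F → Module.finrank ℚ F = 2 → ∀ (p : ℕ) [Fact p.Prime], p ≠ 2 → ¬ (5 ≤ p ∧ ∃ v w : IsDedekindDomain.HeightOneSpectrum (NumberField.RingOfIntegers F), v ≠ w ∧ (p : NumberField.RingOfIntegers F) ∈ v.asIdeal ∧ (p : NumberField.RingOfIntegers F) ∈ w.asIdeal) → ∀ (ρ : Literature.NumberTheory.GaloisRepresentations.FramedGaloisRep F (PadicAlgCl p) 2), ρ.toGaloisRep.IsIrreducible → (∃ 𝒰 : Literature.NumberTheory.Automorphic.BigHeckeGLn.TameLevel 2 F p, 𝒰.IsPadicallyAutomorphic ρ) → (∃ k : ℕ, 2 ≤ k ∧ ∃ m : ℕ, 0 < m ∧ ∀ v : IsDedekindDomain.HeightOneSpectrum (NumberField.RingOfIntegers F), (p : NumberField.RingOfIntegers F) ∈ v.asIdeal → ρ.IsOrdinaryOfWeightAt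 p v k m) → ∃ 𝒰' : Literature.NumberTheory.Automorphic.BigHeckeGLn.TameLevel 2 F p, 𝒰'.IsMaximalAbove ∧ 𝒰'.IsOrdinarilyPadicallyAutomorphic ρ := by
  sorry

/-- **stub_classicalOfOrdinaryPoint** — registered form (statement = `S.stub_classicalOfOrdinaryPoint`;
byte-identical to gen 1 and to line `ordinary-patching-by-regime`). [L–XL; weight character at the ordinary
point (B1) + KT top-degree control (B2) + interior (B3) + ESH over `F` (B4).] -/
theorem stub_classicalOfOrdinaryPoint : ∀ (F : Type) [Field F] [NumberField F], NumberField.IsTotallyComplex F → Module.finrank ℚ F = 2 → ∀ (p : ℕ) [Fact p.Prime], p ≠ 2 → ∀ (hcpt : Literature.NumberTheory.Automorphic.isCompact_glFiniteIntegralLevel 2 F) (ι : PadicAlgCl p ≃+* ℂ) (ρ : Literature.NumberTheory.GaloisRepresentations.FramedGaloisRep F (PadicAlgCl p) 2), ρ.toGaloisRep.IsIrreducible → (∃ 𝒰 : Literature.NumberTheory.Automorphic.BigHeckeGLn.TameLevel 2 F p, 𝒰.IsMaximalAbove ∧ 𝒰.IsOrdinarilyPadicallyAutomorphic ρ) → (∃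 k : ℕ, 2 ≤ k ∧ ∃ m : ℕ, 0 < m ∧ ∀ v : IsDedekindDomain.HeightOneSpectrum (NumberField.RingOfIntegers F), (p : NumberField.RingOfIntegers F) ∈ v.asIdeal → ρ.IsOrdinaryOfWeightAt p v k m) → ∃ π : Literature.NumberTheory.Automorphic.CuspidalAutomorphicRepData 2 F hcpt, π.1.IsLAlgebraic ∧ ∀ᶠ v in Filter.cofinite, Summit.Langlands.SatakeFrobCompatibleAt ι π.1 ρ v := by
  sorry

/-! ## 3. Sanity lemmas (proved): the registered forms ARE the `S.stub_*` statements; the lever's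
weight-blind hypothesis is implied by the crux's ordinary hypothesis and contains the disprover's `m = 0`
degeneration; the lever's conclusion recovers gen 1's slope-zero Hida point and is integral -/

theorem stub_tameLevelSaturation_iff :
    S.stub_tameLevelSaturation ↔ (∀ (F : Type) [Field F] [NumberField F], NumberField.IsTotallyComplex F → Module.finrank ℚ F = 2 → ∀ (p : ℕ) [Fact p.Prime], 5 ≤ p → ∀ (ρ : Literature.NumberTheory.GaloisRepresentations.FramedGaloisRep F (PadicAlgCl p) 2), (∃ 𝒰 : Literature.NumberTheory.Automorphic.BigHeckeGLn.TameLevel 2 F p, 𝒰.IsPadicallyAutomorphic ρ) → ∃ 𝒰' : Literature.NumberTheory.Automorphic.BigHeckeGLn.TameLevel 2 F p, 𝒰'.IsMaximalAbove ∧ 𝒰'.IsPadicallyAutomorphic ρ) :=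
  Iff.rfl

theorem stub_centreForcesOrdinary_iff :
    S.stub_centreForcesOrdinary ↔ (∀ (F : Type) [Field F] [NumberField F], NumberField.IsTotallyComplex F → Module.finrank ℚ F = 2 → ∀ (p : ℕ) [Fact p.Prime], 5 ≤ p → (∃ v w : IsDedekindDomain.HeightOneSpectrum (NumberField.RingOfIntegers F), v ≠ w ∧ (p : NumberField.RingOfIntegers F) ∈ v.asIdeal ∧ (p : NumberField.RingOfIntegers F) ∈ w.asIdeal) → ∀ (𝒰 : Literature.NumberTheory.Automorphic.BigHeckeGLn.TameLevel 2 F p), 𝒰.IsMaximalAbove → ∀ (ρ : Literature.NumberTheory.GaloisRepresentations.FramedGaloisRep F (PadicAlgCl p) 2), ρ.toGaloisRep.IsIrreducible → 𝒰.IsPadicallyAutomorphic ρ → (∀ v : IsDedekindDomain.HeightOneSpectrum (NumberField.RingOfIntegers F), (p : NumberField.RingOfIntegers F) ∈ v.asIdeal → ∃ k m : ℕ, ρ.IsOrdinaryOfWeightAt p v k m) → 𝒰.IsOrdinarilyPadicallyAutomorphic ρ) :=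
  Iff.rfl

theorem stub_complementRegimeFactorisation_iff :
    S.stub_complementRegimeFactorisation ↔ (∀ (F : Type) [Field F] [NumberField F], NumberField.IsTotallyComplex F → Module.finrank ℚ F = 2 → ∀ (p : ℕ) [Fact p.Prime], p ≠ 2 → ¬ (5 ≤ p ∧ ∃ v w : IsDedekindDomain.HeightOneSpectrum (NumberField.RingOfIntegers F), v ≠ w ∧ (p : NumberField.RingOfIntegers F) ∈ v.asIdeal ∧ (p : NumberField.RingOfIntegers F) ∈ w.asIdeal) → ∀ (ρ : Literature.NumberTheory.GaloisRepresentations.FramedGaloisRep F (PadicAlgCl p) 2), ρ.toGaloisRep.IsIrreducible → (∃ 𝒰 : Literature.NumberTheory.Automorphic.BigHeckeGLn.TameLevel 2 F p, 𝒰.IsPadicallyAutomorphic ρ) → (∃ k : ℕ, 2 ≤ k ∧ ∃ m : ℕ, 0 < m ∧ ∀ v : IsDedekindDomain.HeightOneSpectrum (NumberField.RingOfIntegers F), (p : NumberField.RingOfIntegers F) ∈ v.asIdeal → ρ.IsOrdinaryOfWeightAt p v k m) → ∃ 𝒰' : Literature.NumberTheory.Automorphic.BigHeckeGLn.TameLevel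 2 F p, 𝒰'.IsMaximalAbove ∧ 𝒰'.IsOrdinarilyPadicallyAutomorphic ρ) :=
  Iff.rfl

theorem stub_classicalOfOrdinaryPoint_iff :
    S.stub_classicalOfOrdinaryPoint ↔ (∀ (F : Type) [Field F] [NumberField F], NumberField.IsTotallyComplex F → Module.finrank ℚ F = 2 → ∀ (p : ℕ) [Fact p.Prime], p ≠ 2 → ∀ (hcpt : Literature.NumberTheory.Automorphic.isCompact_glFiniteIntegralLevel 2 F) (ι : PadicAlgCl p ≃+* ℂ) (ρ : Literature.NumberTheory.GaloisRepresentations.FramedGaloisRep F (PadicAlgCl p) 2), ρ.toGaloisRep.IsIrreducible → (∃ 𝒰 : Literature.NumberTheory.Automorphic.BigHeckeGLn.TameLevel 2 F p, 𝒰.IsMaximalAbove ∧ 𝒰.IsOrdinarilyPadicallyAutomorphic ρ) → (∃ k : ℕ, 2 ≤ k ∧ ∃ m : ℕ, 0 < m ∧ ∀ v : IsDedekindDomain.HeightOneSpectrum (NumberField.RingOfIntegers F), (p : NumberField.RingOfIntegers F) ∈ v.asIdeal → ρ.IsOrdinaryOfWeightAt p v k m) → ∃ π : Literature.NumberTheory.Automorphic.CuspidalAutomorphicRepData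 2 F hcpt, π.1.IsLAlgebraic ∧ ∀ᶠ v in Filter.cofinite, Summit.Langlands.SatakeFrobCompatibleAt ι π.1 ρ v) :=
  Iff.rfl

/-- The crux's local hypothesis (one parallel `k ≥ 2`, one `m > 0`) implies the lever's weight-blind one
(local reducibility in the `IsOrdinaryOfWeightAt` vocabulary). [folklore] -/
theorem locallyReducible_of_ordinary {F : Type} [Field F] [NumberField F] {p : ℕ} [Fact p.Prime]
    (ρ : FramedGaloisRep F (PadicAlgCl p) 2)
    (hord : ∃ k : ℕ, 2 ≤ k ∧ ∃ m : ℕ, 0 < m ∧ ∀ v : HeightOneSpectrum (𝓞 F), (p : 𝓞 F) ∈ v.asIdeal →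
        ρ.IsOrdinaryOfWeightAt p v k m) :
    ∀ v : HeightOneSpectrum (𝓞 F), (p : 𝓞 F) ∈ v.asIdeal → ∃ k m : ℕ, ρ.IsOrdinaryOfWeightAt p v k m := by
  obtain ⟨k, -, m, -, hkm⟩ := hord
  exact fun v hv => ⟨k, m, hkm v hv⟩

/-- With exponent `0` the lever's hypothesis is literally upper-triangularisability on `Γ_{F_v}` (landed
`Negative.isOrdinaryOfWeight_exponent_zero_iff`): the disprover's `m = 0` degeneration (Disproof §1c) lives
inside S1's HYPOTHESIS — the centre-level statement is weight-blind by design, and the weight is consumed only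
in S4. -/
theorem leverHypothesis_of_upperTriangular {F : Type} [Field F] [NumberField F] {p : ℕ} [Fact p.Prime]
    (ρ : FramedGaloisRep F (PadicAlgCl p) 2) (v : HeightOneSpectrum (𝓞 F))
    (h : ∃ Q : GL (Fin 2) (PadicAlgCl p), ∀ σ : Field.absoluteGaloisGroup (v.adicCompletion F),
      (Q⁻¹ * ρ.toLocal v σ * Q).val 1 0 = 0) :
    ∃ k m : ℕ, ρ.IsOrdinaryOfWeightAt p v k m :=
  ⟨2, 0, (isOrdinaryOfWeight_exponent_zero_iff p (ρ.toLocal v) 2).2 h⟩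

/-- The lever's conclusion recovers gen 1's deliverable: an ordinarily `p`-adically automorphic `ρ` has a
continuous point of the Hida-tower algebra `𝕋^S(𝒰; p)` (compose with `toOrd`; tree lemma
`IsOrdinarilyPadicallyAutomorphic.isIwahoriPadicallyAutomorphic`) — the direction gen 1's
`stub_slopeZeroFactorisation` inverted is not needed on this line. [folklore] -/
theorem iwahoriPoint_of_leverConclusion {F : Type} [Field F] [NumberField F] {p : ℕ} [Fact p.Prime]
    (𝒰 : TameLevel 2 F p) (ρ : FramedGaloisRep F (PadicAlgCl p) 2)
    (h : 𝒰.IsOrdinarilyPadicallyAutomorphic ρ) : 𝒰.IsIwahoriPadicallyAutomorphic ρ :=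
  h.isIwahoriPadicallyAutomorphic

/-- The lever's point is INTEGRAL (landed `Negative.norm_apply_le_one_of_continuous_ord`, Disproof v3 §6):
the conclusion of S1 always comes with `‖y t‖ ≤ 1` — no non-integral junk point of `𝕋^{S,ord}(𝒰)` can be what
S1 produces, and S4 may assume integrality for free. [folklore] -/
theorem leverConclusion_point_integral {F : Type} [Field F] [NumberField F] {p : ℕ} [Fact p.Prime]
    (𝒰 : TameLevel 2 F p) (ρ : FramedGaloisRep F (PadicAlgCl p) 2)
    (h : 𝒰.IsOrdinarilyPadicallyAutomorphic ρ) :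
    ∃ y : OrdinaryHeckeAlgebraGLn 𝒰 →+* PadicAlgCl p,
      Continuous y ∧ 𝒰.IsOrdAssociated y ρ ∧ ∀ t, ‖y t‖ ≤ 1 := by
  obtain ⟨y, hy, hass⟩ := h
  exact ⟨y, hy, hass, norm_apply_le_one_of_continuous_ord 𝒰 y hy⟩

/-! ## 4. The composition: the four stubs imply the crux, BY NAME (kernel-checked, no sorry of its own) -/

/-- **The line concludes the crux.** Case split on the lever's scope `5 ≤ p ∧ (two distinct places of F
above p)`: inside, STUB 0 saturates the tame level at `p`, STUB 1 (the lever, at that level) gives ordinary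
`p`-adic automorphy; outside, STUB 3 (conceded) gives the same; STUB 4 finishes. The crux's `hunr` is not
consumed (Disproof §1a); `2 ≤ k`, `0 < m` are consumed only by STUB 4 (§1c, §1d) and, on the complement, by
STUB 3; `hpm` by STUBS 0/1/3 (§0). -/
theorem ProModularOrdinaryClassical_of (h₀ : S.stub_tameLevelSaturation)
    (h₁ : S.stub_centreForcesOrdinary) (h₃ : S.stub_complementRegimeFactorisation)
    (h₄ : S.stub_classicalOfOrdinaryPoint) :
    Summit.Langlands.Langlands.Theses.SkinnerWilesDefectOne.ProModularOrdinaryClassical := by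
  intro F _ _ hF hdeg p _ hp hcpt ι ρ hirr _hunr hpm hord
  refine h₄ F hF hdeg p hp hcpt ι ρ hirr ?_ hord
  by_cases hsplit : 5 ≤ p ∧ ∃ v w : HeightOneSpectrum (𝓞 F), v ≠ w ∧ (p : 𝓞 F) ∈ v.asIdeal ∧
      (p : 𝓞 F) ∈ w.asIdeal
  · obtain ⟨𝒰', h𝒰', hpm'⟩ := h₀ F hF hdeg p hsplit.1 ρ hpm
    exact ⟨𝒰', h𝒰', h₁ F hF hdeg p hsplit.1 hsplit.2 𝒰' h𝒰' ρ hirr hpm'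
      (locallyReducible_of_ordinary ρ hord)⟩
  · exact h₃ F hF hdeg p hp hsplit ρ hirr hpm hord

/-- **The skeleton**: the crux modulo exactly the four registered stubs (sorries live only inside
`stub_*`). -/
theorem ProModularOrdinaryClassical_proof :
    Summit.Langlands.Langlands.Theses.SkinnerWilesDefectOne.ProModularOrdinaryClassical :=
  ProModularOrdinaryClassical_of stub_tameLevelSaturation stub_centreForcesOrdinary
    stub_complementRegimeFactorisation stub_classicalOfOrdinaryPoint

end Summit.Langlands.Langlands.Cruxes.ProModularOrdinaryClassical.PaskunasCentreSplit

end
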